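import Summits.BirchSwinnertonDyer.Rank1Residual.X2.RankZero
import Literature.NumberTheory.EllipticCurves.Rank1Residual.Typed.MultiplicativeRankZero
import Literature.NumberTheory.EllipticCurves.Wuthrich2014.ReducibleMultiplicativeDivisibility
import Literature.NumberTheory.EllipticCurves.Wuthrich2014.ShaBoundProofs
import Literature.NumberTheory.EllipticCurves.Rank1Residual.X1MainConjecture
import HarnessLib

/-!
# Class X2 (odd multiplicative Eisenstein prime, BOTH signs): at a rank-`0` pair, Mazur's main
# conjecture ⟺ Miller's `BSD(E, p)` — the converse of the tree's rank-`0` glue, from Wuthrich 2014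
# Thm. 16 and Stein–Wuthrich 2013 Thm. 6.1 (+ Greenberg–Stevens at a split prime)
# (cell `bsd-eis`, seat `bsd-eis-k5-c3` gen 6; rung K5 crux 3 `MazurMCOnCellB` = stmt-BirchSwinnertonDyer-19033;
# row A10 = 83 split + 44 non-split cells; THEOREMS ONLY)

HONEST FRAMING (FULL-BSD rank-≤1 programme D-0033, cell `bsd-eis`, home `run/shared/lean/pub/bsd-eis/`;
row A10 = corner X2b: `(E₀, 3)`, `r = 0`, multiplicative Eisenstein `3`, `¬GVPar`). Nothing booked, no
label moves; the class-wide crux `MazurMCOnCellB` is NOT claimed. Theorems only (no definition, no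
named fact, nothing asserted): every published theorem enters as one of the tree's existing NAMED
FACTS, taken as a hypothesis — and here ALL of them are already binders of the K5 route's
`PublishedInputs` (`hWu hJs hJn hHs hHn hGS hGZK hmod hpar`): NO new class-level input.

THE POINT. The tree's rank-`0` glue at a multiplicative prime
(`Typed.bsdp_of_multCharIdeal_{split,nonsplit}_rankZero`, `X2.bsdp_of_mazurMainConjectureAt_of_analyticRank_eq_zero`)
reads Miller's `BSD(E,p)` off the main-conjecture EQUALITY: the analytic constant term (`2[0]⁺_f` at a
non-split prime, MTT §I.14; `[T¹]L · log κ(γ) = 𝓛_p[0]⁺_f` at a split prime, Greenberg–Stevens) against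
Jones's algebraic leading term (Stein–Wuthrich 2013 Thm. 6.1: `f_E(0)·#E(ℚ)_tors² = u·2·#Ш[p^∞]·∏ c_v`,
resp. `f_E(0)·log κ(γ)·#E(ℚ)_tors² = u·𝓛_p·#Ш[p^∞]·∏ c_v`, `Reg_p = 1` in rank `0`). This file runs
the same computation BACKWARDS, starting from Wuthrich's one-sided divisibility (2014 Thm. 16 at a
multiplicative prime with `E[p]` reducible, tree fact `thm16_charIdeal_dvd_multiplicative_of_reducible`:
`g ∈ char_Λ X = (f_E)` with `ι g = ϖ L` non-split / `ι(T g) = ϖ L` split): writing `g = h · f_E`,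
`ord_p(L(E,1)/Ω_E) + 2 ord_p #E(ℚ)_tors = ord_p h(0) + ord_p #Ш + ord_p ∏ c_v` (the `𝓛`-invariant
cancels at a split prime because `𝓛_p ≠ 0`, Barré-Sirieix–Diaz–Gramain–Philibert, tree theorem
`LInvariant_ne_zero_holds`), with `ord_p h(0) ≥ 0`; so the REVERSE rank-`0` inequality
`ord_p(L(E,1)/Ω_E) ≤ ord_p #Ш + ord_p ∏ c_v − 2 ord_p #E(ℚ)_tors` — i.e. `ord_p #Ш_an ≤ ord_p #Ш`,
the cell's `Typed.MissingLowerBoundAt`, implied by `BSD(E,p)` — forces `h ∈ Λˣ` and gives the tree's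
`X2.MazurMainConjectureAt W p` VERBATIM (both clauses, `w := h`). Hence, on the published record:

  **at every rank-`0` X2 pair `(E, p)` (`p ≠ 2` multiplicative, `E[p]` reducible):
  Mazur's main conjecture at `(E,p)` ⟺ `BSD(E,p)` ⟺ `ord_p #Ш(E/ℚ)_an ≤ ord_p #Ш(E/ℚ)(p)`.**

For the cell: crux 3 (`MazurMCOnCellB`: Mazur's MC on every X2b pair) and the ladder's cell target
`X2.TargetB` (`BSD(E,p)` on every X2b pair) are ONE statement modulo `PublishedInputs`
(`mazurMCOnCellB_iff_targetB`); per cell, what is missing at each of the 127 A10 cells is EXACTLY the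
lower bound `3^{ord₃ #Ш_an(E₀)} ∣ #Ш(E₀/ℚ)[3^∞]` at the target (the upper bound is Wuthrich Prop. 21)
— a statement about `Ш(E₀)`, with no Iwasawa theory left in it. Every per-pair road of record
(route G from a closed relative, route T, the `Ш`-unit roads) is a way of obtaining that lower bound.
The non-split half was reached from Greenberg's "analogue of Thm. 4.1" (LNM 1716 §4 pp. 112–113, b2b
fact A103) in `X2/NonsplitMainConjectureConverse.lean` / `X2/NonsplitShaUnitMainConjecture.lean`
(same seat); this file is the sign-free form on the K5 route's own binders.

Contents: §1 `mazurMainConjectureAt_of_padicValRat_le` (core, both signs; per-pair inputs `L(E,1) ≠ 0`,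
`E(ℚ)` and `Ш` finite, the reverse inequality); §2 `…_of_missingLowerBoundAt`, `…_of_bsdp`,
`…_of_shaAn_unit` (`+ hW21`: `r_an = 0 ∧ p ∤ #Ш_an ⟹` MC, any sign, no relative), `…_iff_bsdp`;
§3 cell forms `missingInputB_iff_bsdp_of_cellB`, `mazurMCOnCellB_iff_targetB`,
`missingInputB_of_cellB_of_shaAn_unit`.

References: [Wuthrich2014] Thm. 16 (p. 397), Prop. 21 (p. 400); [SteinWuthrich2013] Thm. 6.1 (p. 20),
§3.1, §4.2; [GreenbergStevens1993]; [BarreSirieixDiazGramainPhilibert1996Manin];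
[MazurTateTeitelbaum1986] §I.14–I.15; [GreenbergLNM1716] §4 (after Thm. 4.1), §5 (closing examples);
[Miller2011LMS] Def. 1.1; [CastellaEtAl2021] Thm. 5.1.4 (proof).
-/

set_option autoImplicit false

noncomputable section

open scoped Classical MatrixGroups ModularForm

open PowerSeries CongruenceSubgroup WeierstrassCurve
  Literature.NumberTheory.EllipticCurves
  Literature.NumberTheory.EllipticCurves.ModularForms
  Literature.NumberTheory.EllipticCurves.Rank1Residual
  Literature.NumberTheory.EllipticCurves.Rank1Residual.Typed
  Literature.NumberTheory.EllipticCurves.Wuthrich2014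
  Literature.NumberTheory.EllipticCurves.SteinWuthrich2013

namespace Summit.BirchSwinnertonDyer.Rank1Residual.X2

/-! ## §1. The core converse, both signs -/

section Converse

variable (W : WeierstrassCurve ℚ) [W.IsElliptic] [W.IsGloballyMinimal] (p : ℕ) [Fact p.Prime]

omit [W.IsGloballyMinimal] in
/-- Valuation bookkeeping, the CONVERSE direction: from `t · #E(ℚ)_tors² = h0 · v · #Ш[p^∞] · ∏ c_v`
in `ℚ_p` with `v` of valuation `0`, `t ≠ 0`, `h0 ≠ 0` of valuation `≥ 0`, and the reverse inequality
`ord_p t ≤ ord_p #Ш + ord_p ∏ c_v − 2 ord_p #E(ℚ)_tors`, conclude `ord_p h0 = 0`. [folklore] -/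
private theorem valuation_eq_zero_of_torsionSq_mul_eq [Finite W.sha] {t : ℚ} (ht0 : t ≠ 0)
    (h0 v : ℚ_[p]) (hh0 : h0 ≠ 0) (hh0v : 0 ≤ h0.valuation) (hv : v.valuation = 0) (hv0 : v ≠ 0)
    (key : (t : ℚ_[p]) * (W.torsionOrder : ℚ_[p]) ^ 2 =
      h0 * v * (Nat.card (AddCommGroup.primaryComponent W.sha p) : ℚ_[p]) *
        (W.tamagawaProduct : ℚ_[p]))
    (hle : padicValRat p t ≤ (padicValNat p W.shaOrder : ℤ) + padicValNat p W.tamagawaProduct -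
      2 * padicValNat p W.torsionOrder) :
    h0.valuation = 0 := by
  have hpP : p.Prime := Fact.out
  haveI : NeZero p := ⟨hpP.ne_zero⟩
  set Shp : ℚ_[p] := (Nat.card (AddCommGroup.primaryComponent W.sha p) : ℚ_[p]) with hShp
  obtain ⟨u₅, hu₅⟩ := exists_unit_natCard_eq_mul_card_primaryComponent W.sha p
  have hSha : (W.shaOrder : ℚ_[p]) = ((u₅ : ℤ_[p]) : ℚ_[p]) * Shp := by
    rw [WeierstrassCurve.shaOrder, hShp]
    exact hu₅
  have htQ0 : (t : ℚ_[p]) ≠ 0 := by exact_mod_cast ht0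
  have hT0 : (W.torsionOrder : ℚ_[p]) ≠ 0 := by
    exact_mod_cast (W.torsionOrder_pos W.finite_torsion_holds).ne'
  have hShp0 : Shp ≠ 0 := by rw [hShp]; exact_mod_cast Nat.card_pos.ne'
  have hc0 : (W.tamagawaProduct : ℚ_[p]) ≠ 0 := by
    exact_mod_cast (W.tamagawaProduct_pos_holds : 0 < W.tamagawaProduct).ne'
  have hvS : Shp.valuation = (padicValNat p W.shaOrder : ℤ) := by
    have h := congrArg Padic.valuation hSha
    rw [Padic.valuation_natCast, Padic.valuation_mul (coe_units_ne_zero p u₅) hShp0,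
      valuation_coe_units_eq_zero, zero_add] at h
    exact h.symm
  have hval := congrArg Padic.valuation key
  rw [Padic.valuation_mul htQ0 (pow_ne_zero 2 hT0), Padic.valuation_pow,
    Padic.valuation_mul (mul_ne_zero (mul_ne_zero hh0 hv0) hShp0) hc0,
    Padic.valuation_mul (mul_ne_zero hh0 hv0) hShp0, Padic.valuation_mul hh0 hv0, hv, hvS,
    Padic.valuation_ratCast] at hval
  simp only [Padic.valuation_natCast, Nat.cast_ofNat, add_zero] at hval
  linarith

/-- **The converse of the rank-`0` glue at an odd multiplicative Eisenstein prime, BOTH signs (core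
form).** Let `W` be a globally minimal model of `E/ℚ`, `p ≠ 2` a prime of multiplicative reduction
(`hmult`) with `E[p]` reducible (`hred`), `L(E,1) ≠ 0` (`hL`), `E(ℚ)` and `Ш(E/ℚ)` finite
(`hEfin hfin`). Assume — all binders of the K5 route's `PublishedInputs` — Wuthrich 2014 Thm. 16 at
a multiplicative prime (`hWu`), Stein–Wuthrich 2013 Thm. 6.1 split / non-split (`hJs hJn`) with the
existence of THE §4.2 heights (`hHs hHn`), Greenberg–Stevens at `(E,p)` (`hGS`); and the REVERSE
rank-`0` inequality `ord_p(L(E,1)/Ω_E) ≤ ord_p #Ш + ord_p ∏ c_v − 2 ord_p #E(ℚ)_tors` (`hlow`). Then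
`X2.MazurMainConjectureAt W p`: `X` torsion, `char_Λ X = (f_E)`, and for THE Mazur–Tate–Teitelbaum
function `L` there is `w ∈ Λˣ` with `ι(T·f_E·w) = ϖ·L` (split) / `ι(f_E·w) = ϖ·L` (non-split).
Proof: Thm. 16 gives `g = h·f_E ∈ char_Λ X` with `ι(T^e g) = ϖ L`; the coefficient of `T^e` is
`h(0) f_E(0) = 2 ϖ [0]⁺_f` (non-split) / `h(0) f_E(0) log κ(γ) = 𝓛_p ϖ [0]⁺_f` (split,
Greenberg–Stevens); Thm. 6.1 in rank `0` (`Reg_p = 1`, Schneider trivial) gives `f_E(0)·#E(ℚ)_tors² =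
u·2·#Ш[p^∞]·∏ c_v` / `f_E(0)·log κ(γ)·#E(ℚ)_tors² = u·𝓛_p·#Ш[p^∞]·∏ c_v`; cancelling `2` / `𝓛_p ≠ 0`:
`(L(E,1)/Ω_E)·#E(ℚ)_tors² = h(0)·u·#Ш[p^∞]·∏ c_v`; valuations and `hlow` force `ord_p h(0) = 0`, so
`h ∈ Λˣ` (`PowerSeries.isUnit_iff_constantCoeff`) and `w := h`.
[cite: Wuthrich2014, Thm. 16 (p. 397)] [cite: SteinWuthrich2013, Thm. 6.1 (p. 20), §3.1 (p. 9), §4.2 (pp. 15–16)]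
[cite: GreenbergStevens1993, Thm. (trivial zero)] [cite: MazurTateTeitelbaum1986, §I.14–I.15]
[cite: GreenbergLNM1716, §5 (closing examples)] -/
theorem mazurMainConjectureAt_of_padicValRat_le
    (hWu : thm16_charIdeal_dvd_multiplicative_of_reducible)
    (hJs : thm61_splitMultiplicative) (hJn : thm61_nonsplitMultiplicative)
    (hHs : exists_isSplitMultCanonical) (hHn : exists_isMultCanonical)
    (hGS : greenberg_stevens (W := W) (p := p)) (hp2 : p ≠ 2)
    (hmult : W.HasMultiplicativeReductionAtPrime p) (hred : ¬ W.HasIrreducibleModPGaloisRep p)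
    (hL : W.entireLFunction 1 ≠ 0) (hEfin : Finite W.toAffine.Point) (hfin : Finite W.sha)
    (hlow : ∀ q : ℚ, W.entireLFunction 1 / (W.realPeriodRat : ℂ) = (q : ℂ) →
      padicValRat p q ≤ (padicValNat p W.shaOrder : ℤ) + padicValNat p W.tamagawaProduct -
        2 * padicValNat p W.torsionOrder) :
    X2.MazurMainConjectureAt W p := by
  intro κ γ hκ hγ hγ' N _ f hf D ϖ hϖ
  have hpP : p.Prime := Fact.out
  haveI := hEfin
  haveI := hfin
  haveI : Finite (AddCommGroup.primaryComponent W.sha p) := inferInstance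
  have hr0 : W.mordellWeilRank = 0 := W.mordellWeilRank_eq_zero_iff_finite.mpr hEfin
  -- Step 0: the rational number `t = ϖ · [0]⁺_f = L(E,1)/Ω_E`, non-zero
  have hΩpos : 0 < W.realPeriodRat := W.realPeriodRat_pos_holds
  have hϖ0 : ϖ ≠ 0 := by
    rintro rfl
    have hper : 0 < plusPeriod f := IsNewform0.plusPeriod_pos_holds hf.1 hf.coeffField_eq_bot
    rw [← hϖ, Rat.cast_zero, zero_mul] at hper
    exact lt_irrefl _ hper
  set s : ℚ := ratPlusSymbol f 0 with hs_def
  set t : ℚ := ϖ * s with ht_def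
  have hLval : W.entireLFunction 1 = (((s : ℝ) * plusPeriod f : ℝ) : ℂ) := hf.entireLFunction_one_eq
  have hq : W.entireLFunction 1 / (W.realPeriodRat : ℂ) = ((t : ℚ) : ℂ) := by
    rw [hLval, ← hϖ, div_eq_iff (Complex.ofReal_ne_zero.mpr hΩpos.ne'), ht_def]
    push_cast
    ring
  have hs0 : s ≠ 0 := by
    intro h0
    apply hL
    rw [hLval, h0]
    simp
  have ht0 : t ≠ 0 := mul_ne_zero hϖ0 hs0
  have htcast : ((t : ℚ) : ℚ_[p]) = (ϖ : ℚ_[p]) * (s : ℚ_[p]) := by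
    rw [ht_def]; push_cast; ring
  have hle : padicValRat p t ≤ (padicValNat p W.shaOrder : ℤ) + padicValNat p W.tamagawaProduct -
      2 * padicValNat p W.torsionOrder := hlow t hq
  -- Step 1 (Wuthrich's Thm. 16 at the multiplicative prime): `X` torsion, the two divisibility
  -- clauses; a generator `fE` of the (principal) characteristic ideal
  haveI : Module.Finite (IwasawaAlgebra p) D.X := D.module_finite_holds hγ
  obtain ⟨hX, hnsp, hsp⟩ := hWu W p hp2 hmult hred hκ hγ hγ' hf D ϖ hϖ
  haveI : (Module.charIdeal (IwasawaAlgebra p) D.X).IsPrincipal := charIdeal_isPrincipal_holds p D.X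
  obtain ⟨fE, hchar⟩ := Submodule.IsPrincipal.principal (Module.charIdeal (IwasawaAlgebra p) D.X)
  have hchar' : D.charIdeal = Ideal.span {fE} := hchar
  refine ⟨hX, fE, hchar', fun hsplit L hLp ↦ ?_, fun hns L hLp ↦ ?_⟩
  · -- SPLIT prime: `ι(T · g) = ϖ · L`, `g = h · fE`
    obtain ⟨g, hgmem, hιg⟩ := hsp hsplit L hLp
    have hgmem' : g ∈ Ideal.span {fE} := by rw [← hchar']; exact hgmem
    obtain ⟨h, hgh⟩ := Ideal.mem_span_singleton'.mp hgmem'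
    -- the Tate parameter datum, THE height, `Reg_p = 1`, Schneider trivially
    obtain ⟨Dq⟩ := (nonempty_tateParameterData_iff_holds (W := W) (p := p)).mpr hsplit
    obtain ⟨Dh, hDh⟩ := hHs W p hp2 Dq
    have hReg : padicRegulator Dh = 1 := padicRegulator_eq_one_of_finite W p Dh
    have hSch : SchneiderConjecture Dh := by
      rw [SchneiderConjecture, hReg]
      exact one_ne_zero
    -- Stein–Wuthrich Thm. 6.1 (split), clause 3, in rank `0`, for the generator `fE`
    obtain ⟨-, -, h3⟩ := hJs W p hp2 Dq κ γ hκ hγ hγ' D hX fE hchar' Dh hDh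
    obtain ⟨u, hu⟩ := h3 hSch inferInstance
    simp only [hr0, zero_add, pow_one, hReg, mul_one, PowerSeries.coeff_zero_eq_constantCoeff] at hu
    -- Greenberg–Stevens: `[T¹]L · log = 𝓛 · [0]⁺_f`
    obtain ⟨-, hGS1⟩ := hGS Dq hf hLp
    have h𝓛0 : LInvariant Dq ≠ 0 := LInvariant_ne_zero_holds Dq
    -- `[T¹] ι(T·g) = g(0) = h(0) fE(0) = ϖ · [T¹]L`
    have hg0' : (PowerSeries.constantCoeff g : ℤ_[p]) =
        PowerSeries.constantCoeff h * PowerSeries.constantCoeff fE := by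
      rw [← hgh, map_mul]
    have h1 : ((PowerSeries.constantCoeff h : ℤ_[p]) : ℚ_[p]) *
        ((PowerSeries.constantCoeff fE : ℤ_[p]) : ℚ_[p]) = ((ϖ : ℚ) : ℚ_[p]) * PowerSeries.coeff 1 L := by
      have hc := congrArg (PowerSeries.coeff 1) hιg
      rw [iwasawaToPowerSeries, PowerSeries.coeff_map, PowerSeries.coeff_succ_X_mul,
        PowerSeries.coeff_zero_eq_constantCoeff, hg0', PowerSeries.coeff_C_mul, map_mul] at hc
      exact_mod_cast hc
    -- the cofactor's constant term is non-zero (else `[T¹]L = 0`, contradicting `𝓛_p [0]⁺_f ≠ 0`)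
    have hh00 : PowerSeries.constantCoeff h ≠ 0 := by
      intro h0'
      have hzero : ((ϖ : ℚ) : ℚ_[p]) * PowerSeries.coeff 1 L = 0 := by rw [← h1, h0']; simp
      have hc1 : PowerSeries.coeff 1 L = 0 := by
        rcases mul_eq_zero.mp hzero with h' | h'
        · exact absurd (by exact_mod_cast h' : ϖ = 0) hϖ0
        · exact h'
      apply h𝓛0
      have hGS0 := hGS1
      rw [hc1, zero_mul] at hGS0
      rcases mul_eq_zero.mp hGS0.symm with h' | h'
      · exact h'
      · exact absurd (by exact_mod_cast h' : s = 0) hs0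
    set h0 : ℚ_[p] := ((PowerSeries.constantCoeff h : ℤ_[p]) : ℚ_[p]) with hh0
    have hh0ne : h0 ≠ 0 := by
      rw [hh0]
      intro h0'
      exact hh00 (by exact_mod_cast (PadicInt.coe_eq_zero.mp h0'))
    have hh0val : 0 ≤ h0.valuation := by
      rw [hh0]
      exact PadicInt.valuation_coe_nonneg
    -- the identity `t · #tors² = h0 · u · #Ш[p^∞] · ∏ c_v` (cancel `𝓛_p ≠ 0`)
    have key : (t : ℚ_[p]) * (W.torsionOrder : ℚ_[p]) ^ 2 =
        h0 * ((u : ℤ_[p]) : ℚ_[p]) *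
          (Nat.card (AddCommGroup.primaryComponent W.sha p) : ℚ_[p]) * (W.tamagawaProduct : ℚ_[p]) := by
      apply mul_left_cancel₀ h𝓛0
      rw [htcast, hh0]
      linear_combination (-(((ϖ : ℚ) : ℚ_[p]) * (W.torsionOrder : ℚ_[p]) ^ 2)) * hGS1 -
        (padicLog p (cyclotomicGenerator p) * (W.torsionOrder : ℚ_[p]) ^ 2) * h1 +
        ((PowerSeries.constantCoeff h : ℤ_[p]) : ℚ_[p]) * hu
    have hvalh0 : h0.valuation = 0 :=
      valuation_eq_zero_of_torsionSq_mul_eq W p ht0 h0 _ hh0ne hh0val (valuation_coe_units_eq_zero p u)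
        (coe_units_ne_zero p u) key hle
    -- `h ∈ Λˣ`
    have hvalh : (PowerSeries.constantCoeff h : ℤ_[p]).valuation = 0 := by
      have h' : (((PowerSeries.constantCoeff h : ℤ_[p]) : ℚ_[p])).valuation = 0 := by
        rw [← hh0]; exact hvalh0
      rw [PadicInt.valuation_coe] at h'
      exact_mod_cast h'
    have hunit0 : IsUnit (PowerSeries.constantCoeff h : ℤ_[p]) := by
      rw [PadicInt.isUnit_iff, PadicInt.norm_eq_zpow_neg_valuation hh00, hvalh]
      simp
    have hunit : IsUnit h := PowerSeries.isUnit_iff_constantCoeff.mpr hunit0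
    refine ⟨hunit.unit, ?_⟩
    rw [IsUnit.unit_spec, mul_assoc, mul_comm fE h, hgh, hιg]
  · -- NON-SPLIT prime: `ι g = ϖ · L`, `g = h · fE`
    obtain ⟨g, hgmem, hιg⟩ := hnsp hns L hLp
    have hgmem' : g ∈ Ideal.span {fE} := by rw [← hchar']; exact hgmem
    obtain ⟨h, hgh⟩ := Ideal.mem_span_singleton'.mp hgmem'
    -- the Tate parameter, THE height, `Reg_p = 1`, Schneider trivially
    obtain ⟨q, ⟨hq0, hq1, hqj⟩, -⟩ := existsUnique_tateJ_eq_of_one_lt_norm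
      (one_lt_norm_j_of_hasMultiplicativeReductionAtPrime (W := W) (p := p) hmult)
    obtain ⟨Dh, hDh⟩ := hHn W p hp2 hmult hns q hq0 hq1 hqj
    have hReg : padicRegulator Dh = 1 := padicRegulator_eq_one_of_finite W p Dh
    have hSch : SchneiderConjecture Dh := by
      rw [SchneiderConjecture, hReg]
      exact one_ne_zero
    -- Stein–Wuthrich Thm. 6.1 (non-split), clause 3, in rank `0`, for the generator `fE`
    obtain ⟨-, -, h3⟩ := hJn W p hp2 hmult hns q hq0 hq1 hqj κ γ hκ hγ hγ' D hX fE hchar' Dh hDh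
    obtain ⟨u, hu⟩ := h3 hSch inferInstance
    simp only [hr0, pow_zero, mul_one, hReg, PowerSeries.coeff_zero_eq_constantCoeff] at hu
    -- constant terms: `g(0) = h(0) fE(0) = ϖ · L(0) = 2 ϖ [0]⁺_f`
    have hL0 : PowerSeries.constantCoeff L = 2 * (s : ℚ_[p]) := hLp.constantCoeff_of_neg_one
    have hg0' : (PowerSeries.constantCoeff g : ℤ_[p]) =
        PowerSeries.constantCoeff h * PowerSeries.constantCoeff fE := by
      rw [← hgh, map_mul]
    have h1 : ((PowerSeries.constantCoeff h : ℤ_[p]) : ℚ_[p]) *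
        ((PowerSeries.constantCoeff fE : ℤ_[p]) : ℚ_[p]) = ((ϖ : ℚ) : ℚ_[p]) * (2 * (s : ℚ_[p])) := by
      have hc := congrArg PowerSeries.constantCoeff hιg
      rw [constantCoeff_iwasawaToPowerSeries, hg0', PadicInt.coe_mul, map_mul,
        PowerSeries.constantCoeff_C, hL0] at hc
      exact hc
    have htQ0 : (t : ℚ_[p]) ≠ 0 := by exact_mod_cast ht0
    have h2t : ((ϖ : ℚ) : ℚ_[p]) * (2 * (s : ℚ_[p])) ≠ 0 := by
      rw [show ((ϖ : ℚ) : ℚ_[p]) * (2 * (s : ℚ_[p])) = 2 * (t : ℚ_[p]) by rw [htcast]; ring]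
      exact mul_ne_zero two_ne_zero htQ0
    have hh00 : PowerSeries.constantCoeff h ≠ 0 := by
      intro h0'
      apply h2t
      rw [← h1, h0']
      simp
    set h0 : ℚ_[p] := ((PowerSeries.constantCoeff h : ℤ_[p]) : ℚ_[p]) with hh0
    have hh0ne : h0 ≠ 0 := by
      rw [hh0]
      intro h0'
      exact hh00 (by exact_mod_cast (PadicInt.coe_eq_zero.mp h0'))
    have hh0val : 0 ≤ h0.valuation := by
      rw [hh0]
      exact PadicInt.valuation_coe_nonneg
    -- the identity `t · #tors² = h0 · u · #Ш[p^∞] · ∏ c_v` (cancel `2`)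
    have key : (t : ℚ_[p]) * (W.torsionOrder : ℚ_[p]) ^ 2 =
        h0 * ((u : ℤ_[p]) : ℚ_[p]) *
          (Nat.card (AddCommGroup.primaryComponent W.sha p) : ℚ_[p]) * (W.tamagawaProduct : ℚ_[p]) := by
      apply mul_left_cancel₀ (two_ne_zero : (2 : ℚ_[p]) ≠ 0)
      rw [htcast, hh0]
      linear_combination ((PowerSeries.constantCoeff h : ℤ_[p]) : ℚ_[p]) * hu -
        (W.torsionOrder : ℚ_[p]) ^ 2 * h1
    have hvalh0 : h0.valuation = 0 :=
      valuation_eq_zero_of_torsionSq_mul_eq W p ht0 h0 _ hh0ne hh0val (valuation_coe_units_eq_zero p u)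
        (coe_units_ne_zero p u) key hle
    have hvalh : (PowerSeries.constantCoeff h : ℤ_[p]).valuation = 0 := by
      have h' : (((PowerSeries.constantCoeff h : ℤ_[p]) : ℚ_[p])).valuation = 0 := by
        rw [← hh0]; exact hvalh0
      rw [PadicInt.valuation_coe] at h'
      exact_mod_cast h'
    have hunit0 : IsUnit (PowerSeries.constantCoeff h : ℤ_[p]) := by
      rw [PadicInt.isUnit_iff, PadicInt.norm_eq_zpow_neg_valuation hh00, hvalh]
      simp
    have hunit : IsUnit h := PowerSeries.isUnit_iff_constantCoeff.mpr hunit0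
    refine ⟨hunit.unit, ?_⟩
    rw [IsUnit.unit_spec, mul_comm, hgh, hιg]

end Converse

end Summit.BirchSwinnertonDyer.Rank1Residual.X2

end
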